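import Literature.AnabelianGeometry.EtaleTheta.SettingModel2CommutatorCusp
import Literature.AnabelianGeometry.EtaleTheta.SettingModelChiTwist
import Literature.AnabelianGeometry.EtaleTheta.CyclotomeZHatSign
import HarnessLib

/-!
# The generator-power twists `θ_u : a ↦ a, b ↦ b^u` MOVE the conjugacy class of the cusp commutator:
# `θ_u(c)` is `F̂₂`-conjugate into the commutator axis `c^Ẑ` only for `u = ±1` — so NO carrier `Γ ⋊_{θ∘χ} G`
# with some `χ(σ) ≠ ±1` has a Galois-surjective subgroup normalising a commutator-axis cusp inertia

Mochizuki, *The étale theta function …*, Publ. RIMS **45** (2009) [EtTh], §1 p. 12 («`Δ_X` … is a profinite free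
group on 2 generators», the cusp of the once-punctured curve) and Def. 2.1 p. 35; the group theory is classical
(finite wreath-product quotients of free groups) [folklore]. Cell abc-iut, layer L2 (NV lane), seat abc-iut-w5-d165
(gen 4). Answers, on the NEGATIVE side and for the whole family at once, the census question raised by
abc-iut-w5-d051 g3 (STATUS 2026-08-26T12:00:42Z, `no_joint_isThm16Origin_isTateOrigin_in_zoo`): «a joint
`IsThm16Origin ∧ IsTateOrigin` inhabitant needs a Galois action on `Γ` that shears `a` by `κ_p^{±2}` AND preserves the
conjugacy class of the commutator axis». THIS FILE: no action built from abc-iut-w5-d024's generator-power twists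
`twist φ : a ↦ a, b ↦ b^{φ}` (`SettingModelChiTwist` — the `Δ`-action of `modelχ`, `modelχq`, `modelχ′`, … via
`twistGfp`, with or without a `b`-power shear of `a`) can do the second, unless the character is `±1`-valued:

* §1 the finite LAMPLIGHTER quotients `W_m = (ℤ/m)^{ℤ/m} ⋊ ℤ/m` of `F̂₂` (`a ↦ (δ_0, 0)`, `b ↦ (0, 1)`; continuous
  `wHat m : F̂₂ →ₜ* W_m` by the profinite universal property, as abc-iut-L2-t1's `hHat`), `wHat_bPow`
  (`b^t ↦ (0, t mod m)`), conjugation of the abelian base = SHIFT (`Wr.conj_inl`);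
* §2 `wHat_shearComm` / `wHat_twist_eta_cElt`: `⁅a·b^t, b^u⁆ ↦ (δ_0 − δ_{u mod m}, 0)`; the axis `c^Ẑ` maps onto the
  integer multiples of `(δ_0 − δ_1, 0)` (`exists_wHat_eq_of_mem_cAxis`, abc-iut's `cAxis_eq_closure_zpowers`);
* §3 the arithmetic: a shift of `δ_0 − δ_u` (`u ≠ 0`) is a multiple of `δ_0 − δ_1` only if `u = ±1`;
* §4 `levelChar_eq_of_isConj_twist_cElt`: `θ_φ(η c)` conjugate into `c^Ẑ` ⇒ `χ_m(φ) = ±1` for every `m ≥ 2`;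
* §5 **`eq_one_or_eq_negOneAut_of_isConj_twist_cElt`**: ⇒ `φ = 1 ∨ φ = −1` in `Aut(Ẑ)` (abc-iut-L4's
  `ZHatLevel.eq_of_levelChar_eq`, compatible levels via `LevelFamily.ofAut`); the sheared form
  `eq_one_or_eq_negOneAut_of_isConj_shearComm`; SHARPNESS `isConj_twist_negOneAut_eta_cElt` (`θ_{−1}(c) ∼ c⁻¹`);
* §6 carrier form: in `Γ ⋊_ψ G` with `gfpFst (ψ σ q) = θ_{χ σ}(gfpFst q)`, an element conjugating the generator of a
  conjugate commutator axis `inl(g₀ c^Ẑ g₀⁻¹)` back into it has `χ(d.right) = ±1`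
  (`chi_right_eq_of_conj_commAxis_mem`); hence a subgroup NORMALISING such an inertia and SURJECTING onto `G`
  (clauses «`I_x ⊲ D_x`», (P4) «`aug(D_x) = G_K`» of a cusp datum) forces `χ ≡ ±1`
  (`forall_chi_eq_of_le_normalizer_commAxis`, `not_exists_normalizer_commAxis_onto`).

READING (numbers, not adjectives): the commutator-axis cusp clause (inhabited at the UNTWISTED Krull model `modelκ′`,
`SettingModelKrullCuspThm16Origin`) and a `Δ`-action through a character with a value `∉ {±1}` (every cyclotomic /
Tate-type twist of the zoo) are jointly UNSATISFIABLE inside the power-twist family; a joint inhabitant needs an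
outer Galois action on `F̂₂` outside this family (the genuine arithmetic one carries pro-unipotent corrections to
`a ↦ a·b^{2κ}`, `b ↦ b^{χ}` making it «special» at the cusp). Nothing here says the conjunction is unsatisfiable in
general. SEMI-SYNTHETIC carriers = consistency evidence only; no side taken on [IUTchIII] Cor. 3.12; typed ≠ proved.
-/

noncomputable section

namespace Literature.AnabelianGeometry.EtaleTheta.SettingModel

open Literature.AnabelianGeometry.SemiGraphs
open Literature.AnabelianGeometry.AbsoluteAnabelian
open CategoryTheory Function
open scoped commutatorElement

/-! ## §1. The finite lamplighter quotients `W_m = (ℤ/m)^{ℤ/m} ⋊ ℤ/m` of `F₂` -/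

section Wreath

variable (m : ℕ+)

/-- The base of the lamplighter group: functions `ℤ/m → ℤ/m`, written multiplicatively. [folklore] -/
abbrev WBase : Type := Multiplicative (ZMod m → ZMod m)

/-- The shift `f ↦ f(· − k)` of the base, as a multiplicative automorphism. [folklore] -/
def wShiftEquiv (k : ZMod m) : WBase m ≃* WBase m where
  toFun f := Multiplicative.ofAdd fun i => Multiplicative.toAdd f (i - k)
  invFun f := Multiplicative.ofAdd fun i => Multiplicative.toAdd f (i + k)
  left_inv f := by
    apply Multiplicative.toAdd.injective
    funext i
    simp only [toAdd_ofAdd, add_sub_cancel_right]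
  right_inv f := by
    apply Multiplicative.toAdd.injective
    funext i
    simp only [toAdd_ofAdd, sub_add_cancel]
  map_mul' f g := by
    apply Multiplicative.toAdd.injective
    funext i
    simp only [toAdd_ofAdd, toAdd_mul, Pi.add_apply]

/-- Pointwise formula for the shift. [cite: MochizukiEtTh2009, §1 p.12] -/
@[simp] theorem toAdd_wShiftEquiv_apply (k : ZMod m) (f : WBase m) (i : ZMod m) :
    Multiplicative.toAdd (wShiftEquiv m k f) i = Multiplicative.toAdd f (i - k) := rfl

/-- The shift action `ℤ/m → Aut((ℤ/m)^{ℤ/m})`. [folklore] -/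
def wShift : Multiplicative (ZMod m) →* MulAut (WBase m) where
  toFun k := wShiftEquiv m (Multiplicative.toAdd k)
  map_one' := by
    refine MulEquiv.ext fun f => ?_
    apply Multiplicative.toAdd.injective
    funext i
    rw [MulAut.one_apply, toAdd_wShiftEquiv_apply, toAdd_one, sub_zero]
  map_mul' k l := by
    refine MulEquiv.ext fun f => ?_
    apply Multiplicative.toAdd.injective
    funext i
    rw [MulAut.mul_apply, toAdd_wShiftEquiv_apply, toAdd_wShiftEquiv_apply, toAdd_wShiftEquiv_apply,
      toAdd_mul, sub_sub, add_comm]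

/-- Pointwise formula for the shift action. [cite: MochizukiEtTh2009, §1 p.12] -/
@[simp] theorem toAdd_wShift_apply (k : Multiplicative (ZMod m)) (f : WBase m) (i : ZMod m) :
    Multiplicative.toAdd (wShift m k f) i = Multiplicative.toAdd f (i - Multiplicative.toAdd k) := rfl

/-- **The lamplighter group `W_m := (ℤ/m)^{ℤ/m} ⋊ ℤ/m`** (a finite 2-generated group). [folklore] -/
abbrev Wr : Type := WBase m ⋊[wShift m] Multiplicative (ZMod m)

/-- [folklore] -/ instance Wr.instTopologicalSpace : TopologicalSpace (Wr m) := ⊥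
/-- [folklore] -/ instance Wr.instDiscreteTopology : DiscreteTopology (Wr m) := ⟨rfl⟩
/-- [folklore] -/ instance Wr.instFinite : Finite (Wr m) :=
  Finite.of_equiv (WBase m × Multiplicative (ZMod m)) SemidirectProduct.equivProd.symm

/-- The delta function `δ_k ∈ (ℤ/m)^{ℤ/m}` (multiplicatively). [folklore] -/
def wDelta (k : ZMod m) : WBase m := Multiplicative.ofAdd (Pi.single k 1)

/-- `δ_k(i) = [i = k]`. [cite: MochizukiEtTh2009, §1 p.12] -/
theorem toAdd_wDelta_apply (k i : ZMod m) :
    Multiplicative.toAdd (wDelta m k) i = if i = k then 1 else 0 := by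
  rw [wDelta, toAdd_ofAdd, Pi.single_apply]

/-- The shift moves deltas: `k · δ_i = δ_{i+k}`. [cite: MochizukiEtTh2009, §1 p.12] -/
theorem wShift_wDelta (k : Multiplicative (ZMod m)) (i : ZMod m) :
    wShift m k (wDelta m i) = wDelta m (i + Multiplicative.toAdd k) := by
  apply Multiplicative.toAdd.injective
  funext j
  rw [toAdd_wShift_apply, toAdd_wDelta_apply, toAdd_wDelta_apply]
  simp only [sub_eq_iff_eq_add]

/-- Conjugating a base element by `(n, k) ∈ W_m` SHIFTS it by `k` (the base is abelian). [cite: MochizukiEtTh2009, §1 p.12] -/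
theorem Wr.conj_inl_mk (n : WBase m) (k : Multiplicative (ZMod m)) (f : WBase m) :
    (SemidirectProduct.inl n * SemidirectProduct.inr k : Wr m) * SemidirectProduct.inl f *
        (SemidirectProduct.inl n * SemidirectProduct.inr k)⁻¹ = SemidirectProduct.inl (wShift m k f) := by
  have hX : (SemidirectProduct.inr k : Wr m) * SemidirectProduct.inl f * SemidirectProduct.inr k⁻¹ =
      SemidirectProduct.inl (wShift m k f) := (SemidirectProduct.inl_aut k f).symm
  calc (SemidirectProduct.inl n * SemidirectProduct.inr k : Wr m) * SemidirectProduct.inl f *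
        (SemidirectProduct.inl n * SemidirectProduct.inr k)⁻¹
      = SemidirectProduct.inl n * (SemidirectProduct.inr k * SemidirectProduct.inl f * SemidirectProduct.inr k⁻¹) *
          SemidirectProduct.inl n⁻¹ := by
        rw [mul_inv_rev, ← map_inv (SemidirectProduct.inr : Multiplicative (ZMod m) →* Wr m) k,
          ← map_inv (SemidirectProduct.inl : WBase m →* Wr m) n]
        simp only [mul_assoc]
    _ = SemidirectProduct.inl (wShift m k f) := by
        rw [hX, ← map_mul, ← map_mul, mul_inv_cancel_comm]

/-- Conjugating a base element by any `w ∈ W_m` SHIFTS it by `w.right`. [cite: MochizukiEtTh2009, §1 p.12] -/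
theorem Wr.conj_inl (w : Wr m) (f : WBase m) :
    w * SemidirectProduct.inl f * w⁻¹ = SemidirectProduct.inl (wShift m w.right f) := by
  have h := Wr.conj_inl_mk m w.left w.right f
  rwa [SemidirectProduct.inl_left_mul_inr_right] at h

/-- The two generators `a_W := (δ_0, 0)`, `b_W := (0, 1)` of `W_m`. [folklore] -/
def wGen : Fin 2 → Wr m :=
  ![SemidirectProduct.inl (wDelta m 0), SemidirectProduct.inr (Multiplicative.ofAdd 1)]

/-- **`ŵ_m : F̂₂ → W_m`**, the continuous extension of `a ↦ a_W, b ↦ b_W`. [folklore] -/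
def wHat : F₂hatT →ₜ* Wr m :=
  (ProfiniteGrp.ProfiniteCompletion.lift (P := ProfiniteGrp.of (Wr m))
    (GrpCat.ofHom (FreeGroup.lift (wGen m)))).hom

/-- `ŵ_m (η g) = lift g`. [cite: MochizukiEtTh2009, §1 p.12] -/
theorem wHat_eta (g : F₂) : wHat m (eta g) = FreeGroup.lift (wGen m) g :=
  lift_hom_toCompletion (ProfiniteGrp.of (Wr m)) (FreeGroup.lift (wGen m)) g

/-- `ŵ_m (η a) = a_W`. [cite: MochizukiEtTh2009, §1 p.12] -/
theorem wHat_eta_zero : wHat m (eta (FreeGroup.of 0)) = SemidirectProduct.inl (wDelta m 0) := by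
  rw [wHat_eta, FreeGroup.lift_apply_of]; rfl

/-- `ŵ_m (η b) = b_W`. [cite: MochizukiEtTh2009, §1 p.12] -/
theorem wHat_eta_one : wHat m (eta (FreeGroup.of 1)) = SemidirectProduct.inr (Multiplicative.ofAdd 1) := by
  rw [wHat_eta, FreeGroup.lift_apply_of]; rfl

/-- **`ŵ_m (b^t) = b_W^{t mod m}`** (two continuous homomorphisms `Ẑ → W_m` agreeing on `ι 1`). [cite: MochizukiEtTh2009, §1 p.12] -/
theorem wHat_bPow (t : ZH) : wHat m (bPow t) = SemidirectProduct.inr (ZHatLevel.level m t) := by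
  have h := ZHatCompletion.monoidHom_ext_of_continuous
    (f₁ := (wHat m).toMonoidHom.comp bPow.toMonoidHom)
    (f₂ := (SemidirectProduct.inr).comp (modN m).toMonoidHom)
    ((wHat m).continuous.comp bPow.continuous)
    ((continuous_of_discreteTopology (f := (SemidirectProduct.inr : Multiplicative (ZMod m) →* Wr m))).comp
      (modN m).continuous) (by
      change wHat m (bPow (iotaZ (Multiplicative.ofAdd 1))) =
        SemidirectProduct.inr (modN m (iotaZ (Multiplicative.ofAdd 1)))
      rw [bPow_iotaZ_one, wHat_eta_one, modN_iotaZ, toAdd_ofAdd, Int.cast_one])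
  have ht := DFunLike.congr_fun h t
  change wHat m (bPow t) = SemidirectProduct.inr (modN m t) at ht
  rw [ht, modN_eq_level]

/-- `ŵ_m` of the inverse image: `η(c) = ⁅η a, η b⁆`. [cite: MochizukiEtTh2009, Def 2.1 p.35] -/
theorem eta_cElt_eq : eta cElt = ⁅eta (FreeGroup.of 0), eta (FreeGroup.of 1)⁆ := map_commutatorElement eta _ _

/-! ## §2. Images of the sheared / twisted cusp commutator `⁅a·b^t, b^u⁆` in `W_m` -/

/-- **`ŵ_m ⁅a·b^t, b^u⁆ = (δ_0 − δ_{u mod m}, 0)`**: the `b`-powers commute past each other, and conjugating `δ_0` by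
`b_W^{u}` shifts it to `δ_u`. [cite: MochizukiEtTh2009, §1 p.12] -/
theorem wHat_shearComm (t u : ZH) :
    wHat m ⁅eta (FreeGroup.of 0) * bPow t, bPow u⁆ =
      SemidirectProduct.inl (wDelta m 0 * (wDelta m (Multiplicative.toAdd (ZHatLevel.level m u)))⁻¹) := by
  rw [map_commutatorElement, map_mul, wHat_eta_zero, wHat_bPow, wHat_bPow, commutatorElement_def]
  set l := ZHatLevel.level m t
  set g := ZHatLevel.level m u
  have h1 : (SemidirectProduct.inl (wDelta m 0) * SemidirectProduct.inr l : Wr m) * SemidirectProduct.inr g *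
      (SemidirectProduct.inl (wDelta m 0) * SemidirectProduct.inr l)⁻¹ =
      SemidirectProduct.inl (wDelta m 0) * SemidirectProduct.inr g * (SemidirectProduct.inl (wDelta m 0))⁻¹ := by
    rw [mul_inv_rev, ← map_inv (SemidirectProduct.inr : Multiplicative (ZMod m) →* Wr m) l]
    have hc : (SemidirectProduct.inr l : Wr m) * SemidirectProduct.inr g * SemidirectProduct.inr l⁻¹ =
        SemidirectProduct.inr g := by
      rw [← map_mul, ← map_mul, mul_inv_cancel_comm]
    calc (SemidirectProduct.inl (wDelta m 0) * SemidirectProduct.inr l : Wr m) * SemidirectProduct.inr g *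
          (SemidirectProduct.inr l⁻¹ * (SemidirectProduct.inl (wDelta m 0))⁻¹)
        = SemidirectProduct.inl (wDelta m 0) *
            (SemidirectProduct.inr l * SemidirectProduct.inr g * SemidirectProduct.inr l⁻¹) *
            (SemidirectProduct.inl (wDelta m 0))⁻¹ := by simp only [mul_assoc]
      _ = _ := by rw [hc]
  rw [h1, ← map_inv (SemidirectProduct.inl : WBase m →* Wr m),
    ← map_inv (SemidirectProduct.inr : Multiplicative (ZMod m) →* Wr m), mul_assoc, mul_assoc,
    ← mul_assoc (SemidirectProduct.inr g), ← SemidirectProduct.inl_aut, ← map_mul, map_inv (wShift m g),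
    wShift_wDelta, zero_add]

/-- The UNTWISTED cusp commutator: `ŵ_m (η c) = (δ_0 − δ_1, 0)`. [cite: MochizukiEtTh2009, §1 p.12] -/
theorem wHat_eta_cElt : wHat m (eta cElt) = SemidirectProduct.inl (wDelta m 0 * (wDelta m 1)⁻¹) := by
  have h := wHat_shearComm m 1 (iotaZ (Multiplicative.ofAdd 1))
  rw [map_one, mul_one, bPow_iotaZ_one, ← eta_cElt_eq] at h
  rw [h, ← modN_eq_level, modN_iotaZ, toAdd_ofAdd, toAdd_ofAdd, Int.cast_one]

/-- **The twisted cusp commutator**: `ŵ_m (θ_φ (η c)) = (δ_0 − δ_{χ_m(φ)}, 0)`. [cite: MochizukiEtTh2009, §1 p.12] -/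
theorem wHat_twist_eta_cElt (φ : MulAut ZH) :
    wHat m (twist φ (eta cElt)) =
      SemidirectProduct.inl (wDelta m 0 * (wDelta m (ZHatLevel.levelChar m φ))⁻¹) := by
  have h := wHat_shearComm m 1 (φ (iotaZ (Multiplicative.ofAdd 1)))
  rw [map_one, mul_one, ← twist_eta_of_one, ← twist_eta_of_zero φ, ← map_commutatorElement, ← eta_cElt_eq] at h
  rw [h, ZHatLevel.levelChar_apply]
  rfl

/-- **The image of the commutator axis**: `ŵ_m (c^Ẑ) = ⟨(δ_0 − δ_1, 0)⟩` — every `x ∈ c^Ẑ` maps to an INTEGER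
multiple `(k · (δ_0 − δ_1), 0)` (`ŵ_m` is continuous into a discrete group). [cite: MochizukiEtTh2009, §1 p.12] -/
theorem exists_wHat_eq_of_mem_cAxis {x : F₂hatT} (hx : x ∈ cAxis) :
    ∃ k : ℤ, wHat m x = SemidirectProduct.inl ((wDelta m 0 * (wDelta m 1)⁻¹) ^ k) := by
  rw [cAxis_eq_closure_zpowers] at hx
  have h1 : wHat m x ∈ closure (((Subgroup.zpowers (eta cElt)).map (wHat m).toMonoidHom : Subgroup (Wr m)) :
      Set (Wr m)) :=
    map_mem_closure (wHat m).continuous hx fun y hy => Subgroup.mem_map_of_mem _ hy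
  rw [(isClosed_discrete _).closure_eq, SetLike.mem_coe, MonoidHom.map_zpowers, Subgroup.mem_zpowers_iff] at h1
  obtain ⟨k, hk⟩ := h1
  refine ⟨k, ?_⟩
  rw [← hk]
  change (wHat m (eta cElt)) ^ k = _
  rw [wHat_eta_cElt, map_zpow]

/-! ## §3. The lamplighter computation: `δ_k − δ_{u+k} = s·(δ_0 − δ_1)` forces `u = ±1` -/

/-- **Key arithmetic**: in `(ℤ/m)^{ℤ/m}` (`m ≥ 2`), if a shift of `δ_0 − δ_u` (`u ≠ 0`) is an integer multiple of
`δ_0 − δ_1`, then `u = ±1`. [cite: MochizukiEtTh2009, §1 p.12] -/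
theorem eq_one_or_eq_neg_one_of_single_sub_single (hm : 1 < (m : ℕ)) {u k : ZMod m} {s : ℤ} (hu : u ≠ 0)
    (h : (Pi.single k (1 : ZMod m) : ZMod m → ZMod m) - Pi.single (u + k) 1 =
      s • ((Pi.single 0 (1 : ZMod m) : ZMod m → ZMod m) - Pi.single 1 1)) :
    u = 1 ∨ u = -1 := by
  haveI : Fact (1 < (m : ℕ)) := ⟨hm⟩
  have h01 : (0 : ZMod m) ≠ 1 := zero_ne_one
  have huk : k ≠ u + k := fun e => hu (by simpa using e.symm)
  have hev : ∀ i : ZMod m, (Pi.single k (1 : ZMod m) : ZMod m → ZMod m) i -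
      (Pi.single (u + k) (1 : ZMod m) : ZMod m → ZMod m) i =
      (s : ZMod m) * ((Pi.single (0 : ZMod m) (1 : ZMod m) : ZMod m → ZMod m) i -
        (Pi.single (1 : ZMod m) (1 : ZMod m) : ZMod m → ZMod m) i) := fun i => by
    have hi := congrFun h i
    simp only [Pi.sub_apply, Pi.smul_apply, zsmul_eq_mul] at hi
    exact hi
  have hk := hev k
  rw [Pi.single_eq_same, Pi.single_eq_of_ne huk, sub_zero] at hk
  by_cases hk0 : k = 0
  · subst hk0
    rw [Pi.single_eq_same, Pi.single_eq_of_ne h01, sub_zero, mul_one] at hk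
    -- `s = 1`; evaluate at `i = 1`
    have h1 := hev 1
    rw [← hk, one_mul, Pi.single_eq_of_ne h01.symm, Pi.single_eq_same, zero_sub, zero_sub, neg_inj, add_zero] at h1
    left
    by_contra hne
    rw [Pi.single_eq_of_ne (Ne.symm hne)] at h1
    exact h01 h1
  · by_cases hk1 : k = 1
    · subst hk1
      rw [Pi.single_eq_of_ne h01.symm, Pi.single_eq_same, zero_sub, mul_neg, mul_one] at hk
      -- `s = -1`; evaluate at `i = 0`
      have h0 := hev 0
      rw [Pi.single_eq_same, Pi.single_eq_of_ne h01, sub_zero, mul_one, ← neg_neg (s : ZMod m), ← hk,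
        zero_sub, neg_inj] at h0
      right
      rw [eq_neg_iff_add_eq_zero]
      by_contra hne
      rw [Pi.single_eq_of_ne (Ne.symm hne)] at h0
      exact h01 h0
    · rw [Pi.single_eq_of_ne hk0, Pi.single_eq_of_ne hk1, sub_zero, mul_zero] at hk
      exact absurd hk.symm h01

/-- `χ_m(φ) ≠ 0` for `m ≥ 2` (it is a unit). [cite: RibesZalesskii2010, Thm 2.7.1] -/
theorem levelChar_ne_zero (hm : 1 < (m : ℕ)) (φ : MulAut ZH) : ZHatLevel.levelChar m φ ≠ 0 := by
  haveI : Fact (1 < (m : ℕ)) := ⟨hm⟩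
  intro h0
  have h := ZHatLevel.levelChar_mul_levelChar_inv m φ
  rw [h0, zero_mul] at h
  exact zero_ne_one h

/-! ## §4. The obstruction at level `m` -/

/-- **Level-`m` obstruction.** If the sheared/twisted cusp commutator `⁅a·b^t, b^u⁆` (`u mod m ≠ 0`, `m ≥ 2`) is
`F̂₂`-conjugate to an element of the commutator axis `c^Ẑ`, then `u ≡ ±1 (mod m)`. [cite: MochizukiEtTh2009, §1 p.12] -/
theorem level_eq_of_isConj_shearComm (hm : 1 < (m : ℕ)) (t u : ZH)
    (hu : Multiplicative.toAdd (ZHatLevel.level m u) ≠ 0) {x : F₂hatT} (hx : x ∈ cAxis)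
    (h : IsConj ⁅eta (FreeGroup.of 0) * bPow t, bPow u⁆ x) :
    Multiplicative.toAdd (ZHatLevel.level m u) = 1 ∨ Multiplicative.toAdd (ZHatLevel.level m u) = -1 := by
  obtain ⟨y, hy⟩ := isConj_iff.mp h
  obtain ⟨k, hk⟩ := exists_wHat_eq_of_mem_cAxis m hx
  have hW := congrArg (wHat m) hy
  rw [map_mul, map_mul, map_inv, wHat_shearComm, Wr.conj_inl, hk, SemidirectProduct.inl_inj, map_mul, map_inv,
    wShift_wDelta, wShift_wDelta, zero_add] at hW
  have hfun := congrArg Multiplicative.toAdd hW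
  simp only [toAdd_mul, toAdd_inv, toAdd_zpow, wDelta, toAdd_ofAdd, ← sub_eq_add_neg] at hfun
  exact eq_one_or_eq_neg_one_of_single_sub_single m hm hu hfun

/-- **Level-`m` obstruction for the twists `θ_φ`**: if `θ_φ(η c)` is `F̂₂`-conjugate into `c^Ẑ`, then
`χ_m(φ) = ±1` for every `m ≥ 2`. [cite: MochizukiEtTh2009, §1 p.12] -/
theorem levelChar_eq_of_isConj_twist_cElt (hm : 1 < (m : ℕ)) (φ : MulAut ZH) {x : F₂hatT} (hx : x ∈ cAxis)
    (h : IsConj (twist φ (eta cElt)) x) :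
    ZHatLevel.levelChar m φ = 1 ∨ ZHatLevel.levelChar m φ = -1 := by
  have h' : IsConj ⁅eta (FreeGroup.of 0) * bPow 1, bPow (φ (iotaZ (Multiplicative.ofAdd 1)))⁆ x := by
    rwa [map_one, mul_one, ← twist_eta_of_one, ← twist_eta_of_zero φ, ← map_commutatorElement, ← eta_cElt_eq]
  have hu : Multiplicative.toAdd (ZHatLevel.level m (φ (iotaZ (Multiplicative.ofAdd 1)))) ≠ 0 := by
    rw [iotaZ_one_eq, ← ZHatLevel.levelChar_apply]; exact levelChar_ne_zero m hm φ
  have := level_eq_of_isConj_shearComm m hm 1 _ hu hx h'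
  rwa [iotaZ_one_eq, ← ZHatLevel.levelChar_apply] at this

end Wreath

/-! ## §5. The obstruction in `Aut(Ẑ)`: only `u = ±1` keep the cusp class -/

/-- An automorphism of `Ẑ` all of whose cyclotomic characters are `±1` is `±1`. [cite: RibesZalesskii2010, Thm 2.7.1] -/
theorem eq_one_or_eq_negOneAut_of_levelChar (φ : MulAut ZH)
    (h : ∀ m : ℕ+, 1 < (m : ℕ) → ZHatLevel.levelChar m φ = 1 ∨ ZHatLevel.levelChar m φ = -1) :
    φ = 1 ∨ φ = ZHatLevel.negOneAut := by
  by_cases hall : ∀ m : ℕ+, ZHatLevel.levelChar m φ = 1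
  · left
    exact ZHatLevel.eq_of_levelChar_eq fun n => by rw [hall n, map_one]
  · right
    obtain ⟨m₀, hm₀⟩ := not_forall.mp hall
    have hm₀1 : 1 < (m₀ : ℕ) := by
      by_contra hle
      have h1 : (m₀ : ℕ) = 1 := le_antisymm (not_lt.mp hle) (Nat.succ_le_of_lt m₀.pos)
      haveI : Subsingleton (ZMod m₀) := by rw [h1]; infer_instance
      exact hm₀ (Subsingleton.elim _ _)
    have hneg : ZHatLevel.levelChar m₀ φ = -1 := (h m₀ hm₀1).resolve_left hm₀
    refine ZHatLevel.eq_of_levelChar_eq fun n => ?_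
    rw [ZHatLevel.levelChar_negOneAut]
    have hN1 : 1 < ((n * m₀ : ℕ+) : ℕ) := by
      rw [PNat.mul_coe]
      exact lt_of_lt_of_le hm₀1 (Nat.le_mul_of_pos_left _ n.pos)
    have hdn : ((n : ℕ+) : ℕ) ∣ ((n * m₀ : ℕ+) : ℕ) := by rw [PNat.mul_coe]; exact dvd_mul_right _ _
    have hdm : ((m₀ : ℕ+) : ℕ) ∣ ((n * m₀ : ℕ+) : ℕ) := by rw [PNat.mul_coe]; exact dvd_mul_left _ _
    have hcn := (ZHatLevel.LevelFamily.ofAut φ).compat n (n * m₀) hdn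
    have hcm := (ZHatLevel.LevelFamily.ofAut φ).compat m₀ (n * m₀) hdm
    simp only [ZHatLevel.LevelFamily.ofAut_c] at hcn hcm
    rcases h (n * m₀) hN1 with hN | hN
    · exfalso
      rw [hN, map_one, hneg] at hcm
      -- `1 = -1` in `ℤ/m₀` contradicts `χ_{m₀}(φ) = -1 ≠ 1`
      exact hm₀ (hneg.trans hcm.symm)
    · rw [hN, map_neg, map_one] at hcn
      exact hcn.symm

/-- **THE OBSTRUCTION.** For `φ ∈ Aut(Ẑ) = Ẑ^×`, the generator-power twist `θ_φ : a ↦ a, b ↦ b^{φ}` of `F̂₂`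
(abc-iut-w5-d024's `twist`, the Galois action on `Δ` of EVERY χ-model in the cell's zoo) carries the cusp
commutator `η(c) = ⁅η a, η b⁆` to an element `F̂₂`-conjugate into the commutator axis `c^Ẑ` ONLY IF `φ = ±1`:
the finite lamplighter quotients `(ℤ/m) ≀ (ℤ/m)` of `F̂₂` see `θ_φ(c) ↦ δ_0 − δ_{χ_m(φ)}`, whose shifts are never
multiples of `δ_0 − δ_1` unless `χ_m(φ) = ±1`. [cite: MochizukiEtTh2009, §1 p.12] -/
theorem eq_one_or_eq_negOneAut_of_isConj_twist_cElt (φ : MulAut ZH) {x : F₂hatT} (hx : x ∈ cAxis)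
    (h : IsConj (twist φ (eta cElt)) x) : φ = 1 ∨ φ = ZHatLevel.negOneAut :=
  eq_one_or_eq_negOneAut_of_levelChar φ fun m hm => levelChar_eq_of_isConj_twist_cElt m hm φ hx h

/-- The same for the SHEARED twists `a ↦ a·b^t, b ↦ b^{φ}` (the shape of the `q`-sheared χ-models' actions on the
generators): `⁅η a · b^t, b^{φ(1)}⁆` is conjugate into `c^Ẑ` only if `φ = ±1`. [cite: MochizukiEtTh2009, §1 p.12] -/
theorem eq_one_or_eq_negOneAut_of_isConj_shearComm (φ : MulAut ZH) (t : ZH) {x : F₂hatT} (hx : x ∈ cAxis)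
    (h : IsConj ⁅eta (FreeGroup.of 0) * bPow t, bPow (φ (iotaZ (Multiplicative.ofAdd 1)))⁆ x) :
    φ = 1 ∨ φ = ZHatLevel.negOneAut := by
  refine eq_one_or_eq_negOneAut_of_levelChar φ fun m hm => ?_
  have hu : Multiplicative.toAdd (ZHatLevel.level m (φ (iotaZ (Multiplicative.ofAdd 1)))) ≠ 0 := by
    rw [iotaZ_one_eq, ← ZHatLevel.levelChar_apply]; exact levelChar_ne_zero m hm φ
  have := level_eq_of_isConj_shearComm m hm t _ hu hx h
  rwa [iotaZ_one_eq, ← ZHatLevel.levelChar_apply] at this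

/-- **Sharpness at `u = −1`**: the inversion twist DOES keep the class — `θ_{−1}(η c) = η(b)⁻¹ · η(c)⁻¹ · η(b)` is
conjugate to `η(c)⁻¹ ∈ c^Ẑ`. [cite: MochizukiEtTh2009, §1 p.12] -/
theorem isConj_twist_negOneAut_eta_cElt :
    IsConj (twist ZHatLevel.negOneAut (eta cElt)) (eta cElt)⁻¹ := by
  have hb : twist ZHatLevel.negOneAut (eta (FreeGroup.of 1)) = (eta (FreeGroup.of 1))⁻¹ := by
    rw [twist_eta_of_one, ZHatLevel.negOneAut_apply, map_inv, bPow_iotaZ_one]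
  rw [eta_cElt_eq, map_commutatorElement, twist_eta_of_zero, hb]
  refine isConj_iff.mpr ⟨eta (FreeGroup.of 1), ?_⟩
  simp only [commutatorElement_def]
  group

/-- `η(c)⁻¹` lies on the commutator axis. [cite: MochizukiEtTh2009, §1 p.12] -/
theorem inv_eta_cElt_mem_cAxis : (eta cElt)⁻¹ ∈ cAxis := by
  rw [← cPow_spec, ← map_inv]
  exact ⟨_, rfl⟩


/-! ## §6. Consequence for the twisted carriers `Γ ⋊_ψ G`: a commutator-axis inertia has no Galois-surjective normaliser -/

section Carrier

variable {G : Type*} [Group G] (ψ : G →* MulAut Gfp) (χ : G → MulAut ZH)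

/-- Conjugation of `inl y` by `(n, σ)` in a semidirect product `Γ ⋊_ψ G`. [cite: MochizukiEtTh2009, §1 p.13] -/
theorem semidirect_conj_inl (n y : Gfp) (σ : G) :
    (SemidirectProduct.inl n * SemidirectProduct.inr σ : Gfp ⋊[ψ] G) * SemidirectProduct.inl y *
        (SemidirectProduct.inl n * SemidirectProduct.inr σ)⁻¹ = SemidirectProduct.inl (n * ψ σ y * n⁻¹) := by
  have hX : (SemidirectProduct.inr σ : Gfp ⋊[ψ] G) * SemidirectProduct.inl y * SemidirectProduct.inr σ⁻¹ =
      SemidirectProduct.inl (ψ σ y) := (SemidirectProduct.inl_aut σ y).symm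
  calc (SemidirectProduct.inl n * SemidirectProduct.inr σ : Gfp ⋊[ψ] G) * SemidirectProduct.inl y *
        (SemidirectProduct.inl n * SemidirectProduct.inr σ)⁻¹
      = SemidirectProduct.inl n * (SemidirectProduct.inr σ * SemidirectProduct.inl y * SemidirectProduct.inr σ⁻¹) *
          SemidirectProduct.inl n⁻¹ := by
        rw [mul_inv_rev, ← map_inv (SemidirectProduct.inr : G →* Gfp ⋊[ψ] G) σ,
          ← map_inv (SemidirectProduct.inl : Gfp →* Gfp ⋊[ψ] G) n]
        simp only [mul_assoc]
    _ = SemidirectProduct.inl (n * ψ σ y * n⁻¹) := by rw [hX, ← map_mul, ← map_mul]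

/-- **Carrier form of the obstruction.** Let `Π = Γ ⋊_ψ G` where `G` acts on `Γ = F̂₂ ×_Ẑ ℤ` THROUGH
generator-power twists on `F̂₂` (`ê∘` anything: `gfpFst (ψ σ q) = θ_{χ σ} (gfpFst q)` — the shape of `actχ`,
`actκ`, and every `twistGfp ∘ character`). If an element `d ∈ Π` conjugates the generator `g₀ c g₀⁻¹` of a
conjugate commutator axis `inl(g₀ c^Ẑ g₀⁻¹)` back INTO that axis, then `χ(d.right) = ±1`. [cite: MochizukiEtTh2009, §1 p.13] -/
theorem chi_right_eq_of_conj_commAxis_mem (hψ : ∀ (σ : G) (q : Gfp), gfpFst (ψ σ q) = twist (χ σ) (gfpFst q))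
    (g₀ : Gfp) (d : Gfp ⋊[ψ] G)
    (hd : d * SemidirectProduct.inl (g₀ * cPowGfp (iotaZ (Multiplicative.ofAdd 1)) * g₀⁻¹) * d⁻¹ ∈
      ((cAxisGfp.map (MulAut.conj g₀).toMonoidHom).map (SemidirectProduct.inl : Gfp →* Gfp ⋊[ψ] G))) :
    χ d.right = 1 ∨ χ d.right = ZHatLevel.negOneAut := by
  obtain ⟨z', hz', hz⟩ := hd
  obtain ⟨z, hz0, rfl⟩ := hz'
  rw [← SemidirectProduct.inl_left_mul_inr_right d, semidirect_conj_inl ψ] at hz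
  have hz2 := SemidirectProduct.inl_injective hz
  have e := congrArg gfpFst hz2
  have hzax : gfpFst z ∈ cAxis := by
    rw [← map_gfpFst_cAxisGfp]; exact Subgroup.mem_map_of_mem _ hz0
  refine eq_one_or_eq_negOneAut_of_isConj_twist_cElt (χ d.right) hzax (isConj_iff.mpr
    ⟨(gfpFst g₀)⁻¹ * gfpFst d.left * twist (χ d.right) (gfpFst g₀), ?_⟩)
  have hZ : gfpFst z = (gfpFst g₀)⁻¹ *
      gfpFst (d.left * (ψ d.right) (g₀ * cPowGfp (iotaZ (Multiplicative.ofAdd 1)) * g₀⁻¹) * d.left⁻¹) *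
        gfpFst g₀ := by
    rw [← e]
    change gfpFst z = (gfpFst g₀)⁻¹ * gfpFst (g₀ * z * g₀⁻¹) * gfpFst g₀
    rw [map_mul, map_mul, map_inv]
    group
  rw [hZ]
  simp only [map_mul, map_inv, hψ, gfpFst_cPowGfp, cPow_spec]
  group

/-- **No Galois-surjective normaliser.** With `Π = Γ ⋊_ψ G` as above: if a subgroup `D ≤ Π` NORMALISES a
conjugate commutator-axis inertia `I = inl(g₀ c^Ẑ g₀⁻¹)` (as the decomposition group of a cusp normalises its
inertia group) and `D ↠ G` (clause (P4) of a cusp datum: `aug(D_x) = G_K`), then `χ(σ) = ±1` for EVERY `σ ∈ G`.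
Hence a carrier twisted by a character `χ` taking some value `≠ ±1` (e.g. a cyclotomic character) admits NO cusp
datum with commutator-axis inertia — the cusp clause of `IsThm16Origin` is out of reach of the whole power-twist
family, independently of the choice of cusp. [cite: MochizukiEtTh2009, §1 p.13] -/
theorem forall_chi_eq_of_le_normalizer_commAxis
    (hψ : ∀ (σ : G) (q : Gfp), gfpFst (ψ σ q) = twist (χ σ) (gfpFst q)) (g₀ : Gfp) (D : Subgroup (Gfp ⋊[ψ] G))
    (hD : D ≤ Subgroup.normalizer ((((cAxisGfp.map (MulAut.conj g₀).toMonoidHom).map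
      (SemidirectProduct.inl : Gfp →* Gfp ⋊[ψ] G)) : Subgroup (Gfp ⋊[ψ] G)) : Set (Gfp ⋊[ψ] G)))
    (hsurj : ∀ σ : G, ∃ d ∈ D, d.right = σ) (σ : G) : χ σ = 1 ∨ χ σ = ZHatLevel.negOneAut := by
  obtain ⟨d, hdD, rfl⟩ := hsurj σ
  refine chi_right_eq_of_conj_commAxis_mem ψ χ hψ g₀ d ?_
  have hc : cPowGfp (iotaZ (Multiplicative.ofAdd 1)) ∈ cAxisGfp := ⟨_, rfl⟩
  have hmem : (SemidirectProduct.inl (g₀ * cPowGfp (iotaZ (Multiplicative.ofAdd 1)) * g₀⁻¹) : Gfp ⋊[ψ] G) ∈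
      ((cAxisGfp.map (MulAut.conj g₀).toMonoidHom).map (SemidirectProduct.inl : Gfp →* Gfp ⋊[ψ] G)) :=
    Subgroup.mem_map_of_mem _ (Subgroup.mem_map_of_mem (MulAut.conj g₀).toMonoidHom hc)
  exact (Subgroup.mem_normalizer_iff.mp (hD hdD) _).mp hmem

/-- The same with the trivial value EXCLUDED reads as a non-existence statement: if `χ σ₀ ∉ {1, −1}` for some `σ₀`,
no subgroup of `Γ ⋊_ψ G` normalising a conjugate commutator-axis inertia surjects onto `G`. [cite: MochizukiEtTh2009, §1 p.13] -/
theorem not_exists_normalizer_commAxis_onto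
    (hψ : ∀ (σ : G) (q : Gfp), gfpFst (ψ σ q) = twist (χ σ) (gfpFst q)) {σ₀ : G} (h1 : χ σ₀ ≠ 1)
    (h2 : χ σ₀ ≠ ZHatLevel.negOneAut) (g₀ : Gfp) :
    ¬ ∃ D : Subgroup (Gfp ⋊[ψ] G), D ≤ Subgroup.normalizer ((((cAxisGfp.map (MulAut.conj g₀).toMonoidHom).map
      (SemidirectProduct.inl : Gfp →* Gfp ⋊[ψ] G)) : Subgroup (Gfp ⋊[ψ] G)) : Set (Gfp ⋊[ψ] G)) ∧
      ∀ σ : G, ∃ d ∈ D, d.right = σ := by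
  rintro ⟨D, hD, hsurj⟩
  rcases forall_chi_eq_of_le_normalizer_commAxis ψ χ hψ g₀ D hD hsurj σ₀ with h | h
  · exact h1 h
  · exact h2 h

end Carrier

end Literature.AnabelianGeometry.EtaleTheta.SettingModel

end
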